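import Summits.BirchSwinnertonDyer.BirchSwinnertonDyer.Theorems.CongruentShaFreeCutTwoAdicSelmerFinite

/-! # Route `CongruentShaFreeCut` (rung S2) — crux `AnalyticRankOneOfRankOneFiniteShaTwo`
(stmt-BirchSwinnertonDyer-19080): the crux from LINK B ALONE (plus refereed and textbook facts)

Cell `bsd-cn100`, prover seat `bsd-cn100-s2-c3` g3. Supports, does not close, stmt-BirchSwinnertonDyer-19080.
HONEST FRAMING: CONDITIONAL on the OPEN research statement Link B
(`CongruentShaFreeCutTwoAdicLinks.TwoAdicCharValueEqHeegnerLogSq`, the `2`-adic anticyclotomic main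
conjecture for `E_n` at the trivial character composed with the `2`-adic Waldspurger/BDP formula at
the ADDITIVE prime `2` — Fan–Wan v2 Thm. 5.18 + 4.2/4.4, Kříž v5 §§9–10, unrefereed), on six
refereed named facts and on two textbook named facts; credits nothing; nothing about BSD, the leaf
or the congruent number problem is proved.

## What is proved

The typer's split of crux B (ty g2, `CongruentShaFreeCutTwoAdicLinks`, p424074) gave
`cruxB_of_twoAdicLinks : facts → Link A → Link B → crux B`. Link A (`TwoAdicControlOfRankOne`) is now
a kernel theorem modulo Poitou–Tate duality and Tate's local Euler–Poincaré characteristic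
(`CongruentShaFreeCutTwoAdicSelmerFinite.twoAdicControlOfRankOne_of_poitouTate_of_localEulerChar`,
p429679). Substituting:

* `heegnerNonTorsionAtTwo_of_linkB` — `HeegnerNonTorsionAtTwo` (the ℚ-level cut of crux B) from
  Link B, Kato, Poitou–Tate and the local Euler characteristic;
* **`cruxB_of_linkB`** — `AnalyticRankOneOfRankOneFiniteShaTwo` from Link B and: `2`-parity,
  modularity, Hoffstein–Luo, Kato, existence of Heegner points (Gross 1984), Gross–Zagier +
  Kolyvagin over `K`, Poitou–Tate (Milne ADT I 4.10(b)/2.3), local Euler characteristic (Milne ADT I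
  2.8). So the research content of item 19080 is EXACTLY Link B — a kernel statement for the
  planner's census and the tribunal's conjunct reading.

[cite: CastellaGrossiLeeSkinner2022, §5.2 (proof of Thm. 5.2.1; shape of a BDP-type p-converse)]
[cite: MilneADT2006, Ch. I, Thm. 4.10(b) and Thm. 2.8] [cite: GrossZagier1986, Thm. I.6.3 with V.§2] -/

noncomputable section

open scoped Classical

namespace Summit.BirchSwinnertonDyer.BirchSwinnertonDyer.Theorems.CongruentShaFreeCutOfLinkB

open WeierstrassCurve NumberField IsDedekindDomain Field Literature.NumberTheory.EllipticCurves
open Literature.NumberTheory.GaloisRepresentations Literature.NumberTheory.GaloisCohomology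
open Summit.BirchSwinnertonDyer.BirchSwinnertonDyer.Theorems.CongruentShaFreeCutOfHeegnerNonTorsion
  (HeegnerNonTorsionAtTwo)
open Summit.BirchSwinnertonDyer.BirchSwinnertonDyer.Theorems.CongruentShaFreeCutTwoAdicLinks
open Summit.BirchSwinnertonDyer.BirchSwinnertonDyer.Theorems.CongruentShaFreeCutTwoAdicSelmerFinite

/-- **`HeegnerNonTorsionAtTwo` from Link B**, Kato (`hKato`), Poitou–Tate (`hPT`) and the local
Euler characteristic (`hEP`): `heegnerNonTorsionAtTwo_of_twoAdicLinks` with Link A supplied by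
`twoAdicControlOfRankOne_of_poitouTate_of_localEulerChar`. CONDITIONAL on the open Link B.
[cite: CastellaGrossiLeeSkinner2022, §5.2 (proof of Thm. 5.2.1)] [cite: MilneADT2006, Ch. I, Thm. 4.10(b) and Thm. 2.8] -/
theorem heegnerNonTorsionAtTwo_of_linkB
    (hKato : ∀ (W : WeierstrassCurve ℚ) [W.IsElliptic] (p : ℕ) [Fact p.Prime],
      kato_finite_of_L_one_ne_zero W p)
    (hPT : ∀ (K : Type) [Field K] [NumberField K], poitouTate_sum_localTatePairing_eq_zero K)
    (hEP : ∀ (K : Type) [Field K] [NumberField K] (v : HeightOneSpectrum (𝓞 K)),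
      localEulerPoincareCharacteristic (v.adicCompletion K))
    (hB : TwoAdicCharValueEqHeegnerLogSq) : HeegnerNonTorsionAtTwo :=
  heegnerNonTorsionAtTwo_of_twoAdicLinks hKato
    (twoAdicControlOfRankOne_of_poitouTate_of_localEulerChar hPT hEP) hB

/-- **Crux B `AnalyticRankOneOfRankOneFiniteShaTwo` from LINK B and named facts only**: `2`-parity
(`hpar`), modularity (`hmod`), Hoffstein–Luo (`hHL`), Kato (`hKato`), Heegner points exist (`hHP`),
Gross–Zagier + Kolyvagin over `K` (`hGZ`), Poitou–Tate (`hPT`), local Euler characteristic (`hEP`),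
and the OPEN Link B (`hB`). This is `cruxB_of_twoAdicLinks` (p424074) with its Link-A hypothesis
DISCHARGED by the kernel theorem `twoAdicControlOfRankOne_of_poitouTate_of_localEulerChar` (p429679):
the research content of crux B is Link B exactly. CONDITIONAL; credits nothing.
[cite: CastellaGrossiLeeSkinner2022, §5.2 (proof of Thm. 5.2.1)] [cite: GrossZagier1986, Thm. I.6.3 with V.§2]
[cite: MilneADT2006, Ch. I, Thm. 4.10(b) and Thm. 2.8] -/
theorem cruxB_of_linkB
    (hpar : ∀ (W : WeierstrassCurve ℚ) [W.IsElliptic] (p : ℕ) [Fact p.Prime], p_parity W p)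
    (hmod : ModularForms.exists_isNewformOf) (hHL : HoffsteinLuo1997_exists_twist_L_one_ne_zero)
    (hKato : ∀ (W : WeierstrassCurve ℚ) [W.IsElliptic] (p : ℕ) [Fact p.Prime],
      kato_finite_of_L_one_ne_zero W p)
    (hHP : ∀ (W : WeierstrassCurve ℚ) (K : Type) [Field K] [NumberField K],
      exists_isHeegnerPoint W K)
    (hGZ : ∀ (W : WeierstrassCurve ℚ) (N : ℕ) [NeZero N] (K : Type) [Field K] [NumberField K],
      analyticRankEK_eq_one_iff_heegner_nonTorsion W N K)
    (hPT : ∀ (K : Type) [Field K] [NumberField K], poitouTate_sum_localTatePairing_eq_zero K)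
    (hEP : ∀ (K : Type) [Field K] [NumberField K] (v : HeightOneSpectrum (𝓞 K)),
      localEulerPoincareCharacteristic (v.adicCompletion K))
    (hB : TwoAdicCharValueEqHeegnerLogSq) :
    Summit.BirchSwinnertonDyer.BirchSwinnertonDyer.Theses.CongruentShaFreeCut.AnalyticRankOneOfRankOneFiniteShaTwo :=
  cruxB_of_twoAdicLinks hpar hmod hHL hKato hHP hGZ
    (twoAdicControlOfRankOne_of_poitouTate_of_localEulerChar hPT hEP) hB

end Summit.BirchSwinnertonDyer.BirchSwinnertonDyer.Theorems.CongruentShaFreeCutOfLinkB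

end
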